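import Summits.HodgeConjecture.HodgeConjecture.Theorems.F0P3cStCharTSFibreRealise        -- ★ p851521 (LH4-p01 g5) «FIBRE-REALISE★» §1: `conj_det_mul_det`, `conj_trace_mul_det` (unitary reciprocity at coefficient level)
import HarnessLib

/-!
# F0 · P3c · line LH6 «StCharTS» — «ROOT-RECIP★» (brick (α-core) of S13b «UPR-LC»): UNITARY RECIPROCITY AT ROOT LEVEL — a root `u` of the characteristic polynomial of
# `y ∈ U(Φ₃)(L⁺_v)` is a unit, and every `u′` with `σ(u)·u′ = 1` is again a root («the eigenvalues of a unitary element come in pairs `λ, (σλ)⁻¹`») [Rogawski1990, §3.1 p. 19; §12.2 p. 173]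

Cell `pub/hodgecm-mathlib`, crux H413 = `stmt-HodgeConjecture-24833` (lane `--supports … --as helper`), route HCCMUnconditional; seat F0P3-p02 (g20); datum road of the (S-𝔇)
organ `stub_EllipticPackage` (`Cruxes/H413/Lines/F0_P3c_StCharTSPaydown.lean`); brick (α) of slice S13b «UPR-LC» (PLAN `F0/P3/F0P3-p02/g20/S13b-PLAN.v1.F0P3p02g20.md`): with ★
«MOVING-ROOT★» (LH4-p03 (g7), `exists_continuousAt_root`) it gives «the moved root of a NORM-ONE simple root stays norm-one» (the root `(σ u(y))⁻¹` lies in the uniqueness window).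
THEOREMS ONLY (no definition ∕ instance ∕ notation ∕ named fact ∕ `sorry`); ★-only imports.
HONEST LABEL: HC_CM is proved only modulo the 7 printed citations (2 remaining named inputs: hLiu418 = `stmt-HodgeConjecture-24832`, h413 = `stmt-HodgeConjecture-24833`)
until rung 0 closes; this file closes no organ, count-neutral.

THE MATHEMATICS.  For `y ∈ U(Φ₃)(L⁺_v)` with `Y` its matrix over `R = L ⊗ L⁺_v`, `σ = c ⊗ 1`: `charpoly Y = X³ − e₁X² + c₁X − e₃` with `e₁ = tr Y`, `e₃ = det Y`, and unitarity gives
`σ(e₃)·e₃ = 1`, `σ(e₁)·e₃ = c₁` (★ FIBRE-REALISE §1), hence `σ(c₁) = e₁·σ(e₃)`.  If `P(u) = 0` then `u·(u² − e₁u + c₁) = e₃` is a unit, so `u` is a unit; and if `σ(u)·u′ = 1`,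
applying `σ` to `P(u) = 0` and multiplying by `e₃·u′³` gives `P(u′) = 0`.
* `eval_charpoly_eq` — `P(x) = x³ − e₁x² + c₁x − e₃` for every `x ∈ R`;
* `isUnit_of_isRoot_charpoly` — a root is a unit;
* `isRoot_charpoly_of_conj_mul_eq_one` — `P(u) = 0`, `σ(u)·u′ = 1 ⇒ P(u′) = 0`;
* `isRoot_charpoly_iff_of_conj_mul_eq_one` — for `σ(u)·u′ = 1` (both units): `P(u) = 0 ↔ P(u′) = 0`.

## References
* [Rogawski1990] J. D. Rogawski, *Automorphic Representations of Unitary Groups in Three Variables*, Ann. of Math. Stud. 123 (1990): §3.1 p. 19 (regular semisimple elements and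
  their eigenvalues); §12.2 p. 173 (`χ = (χ₁, χ₂, χ₃)`, `w χ`: the eigenvalues `α, β, ᾱ⁻¹`); §12.7 Lemma 12.7.2 (proof) p. 193 (`γ = d(α, β, ᾱ⁻¹)`).
-/

set_option autoImplicit false
-- the mandated namespace has the single-problem summit's repeated segment (`HodgeConjecture.HodgeConjecture`)
set_option linter.dupNamespace false

noncomputable section

open Polynomial
open NumberField IsDedekindDomain
open scoped Matrix MatrixGroups
open Literature.NumberTheory.Automorphic Literature.NumberTheory.Automorphic.UnitaryGroup
open Literature.NumberTheory.Rogawski1990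

namespace Summit.HodgeConjecture.HodgeConjecture.Cruxes.H413.F0P3cStCharTSRootRecip

variable (L : Type) [Field L] [NumberField L] [IsCMField L] (v : HeightOneSpectrum (𝓞 ↥(maximalRealSubfield L)))

/-- **The characteristic polynomial of `y ∈ U(Φ₃)(L⁺_v)` evaluated: `P(x) = x³ − tr(Y)·x² + c₁·x − det Y`**, `c₁ = (charpoly Y).coeff 1` (`3 × 3`: `coeff 3 = 1`, `coeff 2 = −tr`,
`coeff 0 = −det`; Mathlib `trace_eq_neg_charpoly_coeff`, `det_eq_sign_charpoly_coeff`, `eval_eq_sum_range'`). [cite: Rogawski1990, §3.1 p. 19] -/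
theorem eval_charpoly_eq (y : Gqs L v) (x : UnitaryGroup.LocalRing L v) :
    ((y.val : GL (Fin 3) (UnitaryGroup.LocalRing L v)).val.charpoly).eval x =
      x ^ 3 - (y.val : GL (Fin 3) (UnitaryGroup.LocalRing L v)).val.trace * x ^ 2 +
        ((y.val : GL (Fin 3) (UnitaryGroup.LocalRing L v)).val.charpoly).coeff 1 * x - (y.val : GL (Fin 3) (UnitaryGroup.LocalRing L v)).val.det := by
  haveI : Nontrivial (UnitaryGroup.LocalRing L v) := by
    obtain ⟨w⟩ : Nonempty (PlacesOver L v) := inferInstance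
    exact ⟨⟨0, 1, fun h => zero_ne_one (congrFun h w)⟩⟩
  set Y := (y.val : GL (Fin 3) (UnitaryGroup.LocalRing L v)).val with hY
  have hdeg : Y.charpoly.natDegree < 4 := by rw [Matrix.charpoly_natDegree_eq_dim, Fintype.card_fin]; norm_num
  have h3 : Y.charpoly.coeff 3 = 1 := by
    have hm := Matrix.charpoly_monic Y
    rw [Monic, leadingCoeff, Matrix.charpoly_natDegree_eq_dim, Fintype.card_fin] at hm
    exact hm
  have h2 : Y.charpoly.coeff 2 = -Y.trace := by
    rw [Matrix.trace_eq_neg_charpoly_coeff, Fintype.card_fin, neg_neg]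
  have h0 : Y.charpoly.coeff 0 = -Y.det := by
    rw [Matrix.det_eq_sign_charpoly_coeff, Fintype.card_fin]
    ring
  rw [eval_eq_sum_range' hdeg, Finset.sum_range_succ, Finset.sum_range_succ, Finset.sum_range_succ, Finset.sum_range_succ, Finset.sum_range_zero,
    h0, h2, h3]
  ring

/-- **A root of the characteristic polynomial of a unitary element is a unit**: `u·(u² − e₁u + c₁) = det Y` and `det Y` is a unit. [cite: Rogawski1990, §3.1 p. 19] -/
theorem isUnit_of_isRoot_charpoly (y : Gqs L v) {u : UnitaryGroup.LocalRing L v}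
    (hu : ((y.val : GL (Fin 3) (UnitaryGroup.LocalRing L v)).val.charpoly).IsRoot u) : IsUnit u := by
  have hdet : IsUnit (y.val : GL (Fin 3) (UnitaryGroup.LocalRing L v)).val.det := Matrix.isUnits_det_units _
  have h := hu.eq_zero
  rw [eval_charpoly_eq] at h
  have hfac : u * (u ^ 2 - (y.val : GL (Fin 3) (UnitaryGroup.LocalRing L v)).val.trace * u +
      ((y.val : GL (Fin 3) (UnitaryGroup.LocalRing L v)).val.charpoly).coeff 1) = (y.val : GL (Fin 3) (UnitaryGroup.LocalRing L v)).val.det := by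
    linear_combination h
  exact isUnit_of_mul_isUnit_left (hfac ▸ hdet)

/-- **UNITARY RECIPROCITY AT ROOT LEVEL**: if `P(u) = 0` and `σ(u)·u′ = 1` then `P(u′) = 0` (`σ = c ⊗ 1` on `L ⊗ L⁺_v`): apply `σ` to `P(u) = 0`, use `σ(det)·det = 1`,
`σ(tr)·det = c₁` (★ FIBRE-REALISE `conj_det_mul_det`, `conj_trace_mul_det`), `σ∘σ = id` (★ `conjLocal_conjLocal_cm`), and multiply by `det·u′³`.
[cite: Rogawski1990, §3.1 p. 19; §12.2 p. 173] -/
theorem isRoot_charpoly_of_conj_mul_eq_one (y : Gqs L v) {u u' : UnitaryGroup.LocalRing L v}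
    (hu : ((y.val : GL (Fin 3) (UnitaryGroup.LocalRing L v)).val.charpoly).IsRoot u)
    (huu' : conjLocal L (IsCMField.complexConj L) v u * u' = 1) :
    ((y.val : GL (Fin 3) (UnitaryGroup.LocalRing L v)).val.charpoly).IsRoot u' := by
  set σ := conjLocal L (IsCMField.complexConj L) v with hσ
  set e₁ := (y.val : GL (Fin 3) (UnitaryGroup.LocalRing L v)).val.trace with he₁
  set e₃ := (y.val : GL (Fin 3) (UnitaryGroup.LocalRing L v)).val.det with he₃
  set c₁ := ((y.val : GL (Fin 3) (UnitaryGroup.LocalRing L v)).val.charpoly).coeff 1 with hc₁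
  have hσσ : ∀ x, σ (σ x) = x := fun x => conjLocal_conjLocal_cm L v x
  have h33 : σ e₃ * e₃ = 1 := F0P3cStCharTSFibreRealise.conj_det_mul_det L v y
  have h13 : σ e₁ * e₃ = c₁ := F0P3cStCharTSFibreRealise.conj_trace_mul_det L v y
  have hc : σ c₁ = e₁ * σ e₃ := by rw [← h13, map_mul, hσσ]
  -- `σ (P u) = 0`
  have hP : u ^ 3 - e₁ * u ^ 2 + c₁ * u - e₃ = 0 := by rw [← eval_charpoly_eq]; exact hu.eq_zero
  have hσP : σ u ^ 3 - σ e₁ * σ u ^ 2 + σ c₁ * σ u - σ e₃ = 0 := by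
    have := congrArg σ hP
    simpa only [map_sub, map_add, map_mul, map_pow, map_zero] using this
  -- multiply by `e₃ · u′³` and substitute `σ u · u′ = 1`
  have key : e₃ * u' ^ 3 * (σ u ^ 3 - σ e₁ * σ u ^ 2 + σ c₁ * σ u - σ e₃) =
      e₃ * (σ u * u') ^ 3 - e₃ * σ e₁ * u' * (σ u * u') ^ 2 + e₃ * σ c₁ * u' ^ 2 * (σ u * u') - e₃ * σ e₃ * u' ^ 3 := by ring
  rw [hσP, mul_zero, huu'] at key
  simp only [one_pow, mul_one] at key
  -- `0 = e₃ − c₁ u′ + e₁ u′² − u′³`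
  rw [IsRoot.def, eval_charpoly_eq, ← he₁, ← he₃, ← hc₁]
  rw [hc] at key
  linear_combination key + (-u') * h13 + (e₁ * u' ^ 2 - u' ^ 3) * h33

/-- **Roots pair off under `u ↦ (σu)⁻¹`**: for `σ(u)·u′ = 1`, `P(u) = 0 ↔ P(u′) = 0` (the symmetric reading, using `σ(u′)·u = 1` from `σ∘σ = id`). [cite: Rogawski1990, §12.2 p. 173] -/
theorem isRoot_charpoly_iff_of_conj_mul_eq_one (y : Gqs L v) {u u' : UnitaryGroup.LocalRing L v}
    (huu' : conjLocal L (IsCMField.complexConj L) v u * u' = 1) :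
    ((y.val : GL (Fin 3) (UnitaryGroup.LocalRing L v)).val.charpoly).IsRoot u ↔
      ((y.val : GL (Fin 3) (UnitaryGroup.LocalRing L v)).val.charpoly).IsRoot u' := by
  have hσσ : ∀ x, conjLocal L (IsCMField.complexConj L) v (conjLocal L (IsCMField.complexConj L) v x) = x := fun x =>
    conjLocal_conjLocal_cm L v x
  have hu'u : conjLocal L (IsCMField.complexConj L) v u' * u = 1 := by
    have := congrArg (conjLocal L (IsCMField.complexConj L) v) huu'
    rw [map_mul, hσσ, map_one, mul_comm] at this
    exact this
  exact ⟨fun h => isRoot_charpoly_of_conj_mul_eq_one L v y h huu', fun h => isRoot_charpoly_of_conj_mul_eq_one L v y h hu'u⟩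

end Summit.HodgeConjecture.HodgeConjecture.Cruxes.H413.F0P3cStCharTSRootRecip

end
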